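import Literature.AlgebraicTopology.CharacteristicClasses.LineEulerNumberLocalModel
import Literature.AlgebraicTopology.CharacteristicClasses.ProjectiveSpaceLowHomology
import Literature.AlgebraicTopology.SingularHomology.UniversalCoefficientsFree
import Literature.AlgebraicTopology.SingularHomology.SphereLikeToLocal
import Literature.AlgebraicTopology.SingularHomology.SphereHomology
import Literature.AlgebraicTopology.SingularHomology.LocalDegreeSign
import Literature.AlgebraicTopology.SingularHomology.ChartTransitionLocalDegree
import HarnessLib

/-!
# The preferred generator of the fibre pair `(F, F ∖ 0)` of a complex line pairs to `±1` with every
# local orientation generator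

J. Milnor, J. Stasheff, *Characteristic Classes* (1974), §9, Thm. 9.1: the Thom class `u` of an
oriented `n`-plane bundle is characterised by "the restriction of `u` to `(F, F₀)` is equal to the
preferred generator `u_F`" of `Hⁿ(F, F₀; ℤ) ≅ ℤ`, the generator taking the value `+1` on the
orientation generator of `Hₙ(F, F₀; ℤ)`.  In the tree the Thom class of a complex LINE bundle is
normalised differently — by `s_∞^* t = 0` and the Mayer–Vietoris generator `ω` of `H²(ℂP¹)`
(`LineThomClassLocal`, `LineEulerClass`) — and its fibre restriction in relative form is the class
`ω^rel_vec(1) = α^* ω^rel(1) ∈ H²(F, F ∖ 0; ℤ)` of `LineEulerNumberLocalModel` (`α u = [u : 1]`).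
This file proves that the two normalisations agree UP TO SIGN, in the only form the localisation
formula needs:

* `exists_generator_kroneckerPairing_omegaModel_eq_one` — **`⟨ω(1), c⟩ = 1` for a generator `c` of
  `H₂(ℙ(F ⊕ ℂ); ℤ) ≅ ℤ`**: `ℙ(F ⊕ ℂ) ≅ ℂP¹ ≅ S²` (`projectiveLineHomeomorph`,
  `onePointEquivSphereOfFinrankEq`), so `H₁ = 0` and the Kronecker map `H² → Hom(H₂, ℤ)` is
  bijective (universal coefficients, A. Hatcher, *Algebraic Topology* (2002), §3.1 Thm. 3.2,
  `kroneckerPairing_bijective_of_isZero`); `ω(·)` is a bijection `ℤ → H²`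
  (`IsSphereLike.omegaFibre_bijective`), whence `⟨ω(1), -⟩` generates `Hom(H₂, ℤ)` and takes the
  value `±1` on a generator;
* `isOpenEmbedding_vecEmbed`, `isIso_map_vecEmbed` — `α` is an open embedding (the affine chart
  `{pr₂ ≠ 0}` read backwards), so `α_* : H₂(F | 0) ≅ H₂(ℙ | [0 : 1])` (excision,
  `localHomology.isIso_map_of_isOpenEmbedding_of_eq`);
* **`relKroneckerM_omegaRelVec_eq_one_or_eq_neg_one`** — for every generator `γ` of
  `H₂(F, F ∖ 0; ℤ)`: **`⟨ω^rel_vec(1), γ⟩ = ±1`**.  Indeed `⟨α^* ω^rel, γ⟩ = ⟨ω^rel, α_* γ⟩`,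
  `α_* γ = j c'` for a generator `c'` of `H₂(ℙ)` (`j : H₂(ℙ) → H₂(ℙ | pt)` is an isomorphism for a
  `2`-sphere, Hatcher §3.3 p. 236, `isIso_toLocal_of_homeomorph_sphere`), and
  `⟨ω^rel, j c'⟩ = ⟨ω, c'⟩ = ±⟨ω, c⟩ = ±1` (`kroneckerPairing_toAbsolute`; two generators of `ℤ` agree
  up to sign).

Consequence (sequel): the local index of a transverse zero of a section of a complex line bundle is
`±1`, the sign of the Jacobian of the section read in a trivialisation, uniformly in the zero.
Everything is proved; no named facts.

## References

* [MilnorStasheff1974] J. Milnor, J. Stasheff, Characteristic Classes, PUP 1974, §9 Thm. 9.1.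
* [HatcherAT2002] A. Hatcher, Algebraic Topology, CUP 2002, Example 0.6, Cor. 2.14, Example 2.42,
  §3.1 Thm. 3.2, §3.3 pp. 231, 236.
* [Hirzebruch1966] F. Hirzebruch, Topological Methods in Algebraic Geometry, 3rd ed. 1966, §4.2.
-/

noncomputable section

open CategoryTheory Limits Function Set Topology Literature.AlgebraicTopology.SingularHomology
open scoped LinearAlgebra.Projectivization

namespace Literature.AlgebraicTopology.CharacteristicClasses

variable (F : Type) [NormedAddCommGroup F] [NormedSpace ℂ F] (hF : Module.finrank ℂ F = 1)

/-! ### The model line `ℙ(F ⊕ ℂ) ≅ ℂP¹ ≅ S²` -/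

section ModelLine

include hF in
/-- `F ⊕ ℂ` is finite-dimensional. [folklore] -/
theorem finiteDimensional_model_prod : FiniteDimensional ℂ (F × ℂ) :=
  haveI : FiniteDimensional ℂ F := Module.finite_of_finrank_eq_succ hF
  inferInstance

include hF in
/-- `dim (F ⊕ ℂ) = 2`. [folklore] -/
theorem finrank_model_prod : Module.finrank ℂ (F × ℂ) = 2 := by
  haveI : FiniteDimensional ℂ F := Module.finite_of_finrank_eq_succ hF
  rw [Module.finrank_prod, hF, Module.finrank_self]

/-- **`ℂP¹ = OnePoint ℂ ≅ ℙ(F ⊕ ℂ)`** (the projective line through `[f₀ : 0]`, `[0 : 1]`).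
[cite: HatcherAT2002, Example 0.6] -/
def onePointHomeomorphModel : OnePoint ℂ ≃ₜ ℙ ℂ (F × ℂ) :=
  haveI := finiteDimensional_model_prod F hF
  projectiveLineHomeomorph ((modelVec F hF, 0) : F × ℂ) ((0, 1) : F × ℂ) (modelφ₁ F hF) (modelφ₂ F)
    (modelDualPair F hF).apply₁₁ (modelDualPair F hF).apply₁₂ (modelDualPair F hF).apply₂₁
    (modelDualPair F hF).apply₂₂ (finrank_model_prod F hF)

/-- **`S² ≅ ℙ(F ⊕ ℂ)`** (stereographic projection and the projective line). [cite: HatcherAT2002, Example 0.6] -/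
def sphereHomeomorphModel : (Metric.sphere (0 : EuclideanSpace ℝ (Fin 3)) 1) ≃ₜ ℙ ℂ (F × ℂ) :=
  (onePointEquivSphereOfFinrankEq (by rw [Complex.finrank_real_complex]; rfl)).symm.trans
    (onePointHomeomorphModel F hF)

include hF in
/-- **`H₁(ℙ(F ⊕ ℂ); M) = 0`.** [cite: HatcherAT2002, Example 2.42] -/
theorem isZero_singularHomology_model_one (R : Type) [CommRing R] (M : Type) [AddCommGroup M] [Module R M] :
    IsZero (singularHomology R M (ℙ ℂ (F × ℂ)) 1) :=
  haveI := finiteDimensional_model_prod F hF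
  isZero_singularHomology_projectivization_one R M ((modelVec F hF, 0) : F × ℂ) ((0, 1) : F × ℂ)
    (modelφ₁ F hF) (modelφ₂ F) (modelDualPair F hF).apply₁₁ (modelDualPair F hF).apply₁₂
    (modelDualPair F hF).apply₂₁ (modelDualPair F hF).apply₂₂

include hF in
/-- **`H₂(ℙ(F ⊕ ℂ); ℤ) ≅ ℤ`**: a generator exists (from `H₂(S²; ℤ) ≅ ℤ`). [cite: HatcherAT2002, Cor. 2.14] -/
theorem exists_generator_singularHomology_model_two :
    ∃ (c : singularHomology ℤ ℤ (ℙ ℂ (F × ℂ)) 2) (e : singularHomology ℤ ℤ (ℙ ℂ (F × ℂ)) 2 ≃ₗ[ℤ] ℤ), e c = 1 := by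
  obtain ⟨ι⟩ := nonempty_singularHomology_sphere_iso_holds ℤ ℤ (n := 2) (by norm_num)
  let e : singularHomology ℤ ℤ (ℙ ℂ (F × ℂ)) 2 ≃ₗ[ℤ] ℤ :=
    ((singularHomology.mapIso ℤ ℤ (sphereHomeomorphModel F hF) 2).symm ≪≫ ι).toLinearEquiv ≪≫ₗ ULift.moduleEquiv
  exact ⟨e.symm 1, e, e.apply_symm_apply 1⟩

include hF in
/-- **The canonical generator `ω(1) ∈ H²(ℙ(F ⊕ ℂ); ℤ)` evaluates to `1` on a generator of
`H₂(ℙ(F ⊕ ℂ); ℤ) ≅ ℤ`**: `ω` generates `H²` (`omegaFibre_bijective`), `H₁ = 0`, so the Kronecker map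
`H² → Hom(H₂, ℤ)` is bijective (universal coefficients, Hatcher Thm. 3.2) and `⟨ω(1), -⟩` generates
`Hom(H₂, ℤ) ≅ ℤ`; hence `⟨ω(1), c⟩ = ±1` on a generator `c`, `= 1` after a sign change.
[cite: HatcherAT2002, §3.1 Thm. 3.2] -/
theorem exists_generator_kroneckerPairing_omegaModel_eq_one :
    ∃ c : singularHomology ℤ ℤ (ℙ ℂ (F × ℂ)) 2,
      (∃ e : singularHomology ℤ ℤ (ℙ ℂ (F × ℂ)) 2 ≃ₗ[ℤ] ℤ, e c = 1) ∧
        kroneckerPairing ℤ ℤ (ℙ ℂ (F × ℂ)) 2 (omegaModel F hF ℤ ℤ 1) c = 1 := by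
  obtain ⟨c₀, e, hc₀⟩ := exists_generator_singularHomology_model_two F hF
  have hK : Function.Bijective (kroneckerPairing ℤ ℤ (ℙ ℂ (F × ℂ)) 2) :=
    kroneckerPairing_bijective_of_isZero ℤ (ℙ ℂ (F × ℂ)) 1 (isZero_singularHomology_model_one F hF ℤ ℤ)
  obtain ⟨x, hx⟩ := hK.2 e.toLinearMap
  obtain ⟨m, rfl⟩ := ((modelSphereLike F hF).omegaFibre_bijective ℤ ℤ).2 x
  -- `1 = e c₀ = ⟨ω(m), c₀⟩ = m ⟨ω(1), c₀⟩`
  have h1 : kroneckerPairing ℤ ℤ (ℙ ℂ (F × ℂ)) 2 ((modelSphereLike F hF).omegaFibre ℤ ℤ m) c₀ = 1 := by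
    have := LinearMap.congr_fun hx c₀
    rw [LinearEquiv.coe_coe, hc₀] at this
    exact this
  -- `a ↦ ⟨ω(a), c₀⟩` is additive, hence `⟨ω(m), c₀⟩ = m ⟨ω(1), c₀⟩`
  have hadd : ∀ a b : ℤ,
      kroneckerPairing ℤ ℤ (ℙ ℂ (F × ℂ)) 2 ((modelSphereLike F hF).omegaFibre ℤ ℤ (a + b)) c₀ =
        kroneckerPairing ℤ ℤ (ℙ ℂ (F × ℂ)) 2 ((modelSphereLike F hF).omegaFibre ℤ ℤ a) c₀ +
          kroneckerPairing ℤ ℤ (ℙ ℂ (F × ℂ)) 2 ((modelSphereLike F hF).omegaFibre ℤ ℤ b) c₀ := by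
    intro a b
    rw [(modelSphereLike F hF).omegaFibre_add ℤ ℤ, map_add, LinearMap.add_apply]
  have hzero : kroneckerPairing ℤ ℤ (ℙ ℂ (F × ℂ)) 2 ((modelSphereLike F hF).omegaFibre ℤ ℤ 0) c₀ = 0 := by
    rw [((modelSphereLike F hF).omegaFibre_eq_zero_iff ℤ ℤ 0).2 rfl, map_zero, LinearMap.zero_apply]
  let φ : ℤ →+ ℤ :=
    { toFun := fun a ↦ kroneckerPairing ℤ ℤ (ℙ ℂ (F × ℂ)) 2 ((modelSphereLike F hF).omegaFibre ℤ ℤ a) c₀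
      map_zero' := hzero
      map_add' := hadd }
  have hm : kroneckerPairing ℤ ℤ (ℙ ℂ (F × ℂ)) 2 ((modelSphereLike F hF).omegaFibre ℤ ℤ m) c₀ =
      m * kroneckerPairing ℤ ℤ (ℙ ℂ (F × ℂ)) 2 ((modelSphereLike F hF).omegaFibre ℤ ℤ 1) c₀ := by
    have hφ := AddMonoidHom.apply_int ℤ φ m
    rw [zsmul_eq_mul, Int.cast_id] at hφ
    exact hφ
  rw [hm] at h1
  rcases Int.eq_one_or_neg_one_of_mul_eq_one' h1 with ⟨-, hk⟩ | ⟨-, hk⟩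
  · exact ⟨c₀, ⟨e, hc₀⟩, hk⟩
  · refine ⟨-c₀, isGenerator_neg ⟨e, hc₀⟩, ?_⟩
    change kroneckerPairing ℤ ℤ (ℙ ℂ (F × ℂ)) 2 ((modelSphereLike F hF).omegaFibre ℤ ℤ 1) (-c₀) = 1
    rw [map_neg, hk, neg_neg]

end ModelLine

/-! ### The fibre embedding `u ↦ [u : 1]` is an open embedding -/

section Embedding

/-- `F ≅ {v ∈ F ⊕ ℂ | pr₂ v = 1}`, `u ↦ (u, 1)`. [folklore] -/
def levelOneHomeomorph : F ≃ₜ ↥{v : F × ℂ | (modelφ₂ F) v = 1} where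
  toFun u := ⟨(u, 1), rfl⟩
  invFun v := v.1.1
  left_inv _ := rfl
  right_inv v := by
    obtain ⟨⟨u, z⟩, hz⟩ := v
    change z = 1 at hz
    subst hz
    rfl
  continuous_toFun := (continuous_id.prodMk continuous_const).subtype_mk _
  continuous_invFun := continuous_fst.comp continuous_subtype_val

/-- `u ↦ [u : 1]` is the affine chart `{pr₂ ≠ 0} ≅ {pr₂ = 1} ≅ F` read backwards. [folklore] -/
theorem vecEmbed_eq_comp :
    (vecEmbed F : F → ℙ ℂ (F × ℂ)) =
      (Subtype.val : ↥(chartDomain ((modelφ₂ F : (F × ℂ) →L[ℂ] ℂ) : Module.Dual ℂ (F × ℂ))) → ℙ ℂ (F × ℂ)) ∘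
        (affineChartHomeomorph (modelφ₂ F)).symm ∘ levelOneHomeomorph F := by
  funext u
  rfl

/-- **`u ↦ [u : 1]` is an open embedding `F ↪ ℙ(F ⊕ ℂ)`** (onto the affine chart `{pr₂ ≠ 0}`).
[cite: Hirzebruch1966, §4.2] -/
theorem isOpenEmbedding_vecEmbed : IsOpenEmbedding (vecEmbed F) := by
  rw [vecEmbed_eq_comp]
  exact (IsOpen.isOpenEmbedding_subtypeVal (isOpen_chartDomain _ (modelφ₂ F).continuous)).comp
    ((affineChartHomeomorph (modelφ₂ F)).symm.isOpenEmbedding.comp (levelOneHomeomorph F).isOpenEmbedding)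

/-- `[0 : 1]` is the image of the origin. [folklore] -/
theorem vecEmbed_zero : vecEmbed F 0 = zeroPt F := rfl

include hF in
/-- **`α_* : Hₖ(F | 0) → Hₖ(ℙ(F ⊕ ℂ) | [0 : 1])` is an isomorphism** (excision along the open
embedding `α = (u ↦ [u : 1])`). [cite: HatcherAT2002, §3.3 p. 231] -/
theorem isIso_map_vecEmbed (R : Type) [CommRing R] (M : Type) [AddCommGroup M] [Module R M] (k : ℕ) :
    IsIso (relativeSingularHomology.map R M (vecEmbed F) (mapsTo_vecEmbed F) k) := by
  haveI := finiteDimensional_model_prod F hF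
  haveI : T2Space (ℙ ℂ (F × ℂ)) := t2Space_of_finiteDimensional ℂ (F × ℂ)
  exact localHomology.isIso_map_of_isOpenEmbedding_of_eq R M (vecEmbed F) (isOpenEmbedding_vecEmbed F) 0
    (vecEmbed_zero F) k

end Embedding

/-! ### `⟨ω^rel_vec, γ⟩ = ±1` -/

section Unit

include hF in
/-- **The preferred generator pairs to `±1` with every local orientation generator**: for every
generator `γ` of `H₂(F, F ∖ 0; ℤ) ≅ ℤ`,

  `⟨ω^rel_vec(1), γ⟩ = ±1`.

Proof: `⟨α^* ω^rel, γ⟩ = ⟨ω^rel, α_* γ⟩` with `α_* γ` a generator of `H₂(ℙ | [0 : 1])` (excision);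
`j : H₂(ℙ) → H₂(ℙ | [0 : 1])` is an isomorphism (`ℙ ≅ S²`, Hatcher §3.3 p. 236), so `α_* γ = j c'`
for a generator `c'` of `H₂(ℙ; ℤ) ≅ ℤ`, and `⟨ω^rel, j c'⟩ = ⟨ω, c'⟩ = ±⟨ω, c⟩ = ±1` for the generator
`c` with `⟨ω(1), c⟩ = 1` (two generators of `ℤ` agree up to sign).  This is the homological content
of Milnor–Stasheff's normalisation "the restriction of `u` to `(F, F₀)` is the preferred generator"
for the tree's Thom class (normalised instead by `s_∞^* t = 0` and the Mayer–Vietoris generator `ω`).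
[cite: MilnorStasheff1974, §9 Thm. 9.1] [cite: HatcherAT2002, §3.3 p. 236] -/
theorem relKroneckerM_omegaRelVec_eq_one_or_eq_neg_one {γ : localHomology ℤ ℤ F (0 : F) 2}
    (hγ : ∃ e : localHomology ℤ ℤ F (0 : F) 2 ≃ₗ[ℤ] ℤ, e γ = 1) :
    relKroneckerM ℤ F ({0}ᶜ : Set F) 2 (omegaRelVec F hF ℤ ℤ 1) γ = 1 ∨
      relKroneckerM ℤ F ({0}ᶜ : Set F) 2 (omegaRelVec F hF ℤ ℤ 1) γ = -1 := by
  haveI := finiteDimensional_model_prod F hF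
  haveI : T2Space (ℙ ℂ (F × ℂ)) := t2Space_of_finiteDimensional ℂ (F × ℂ)
  -- Step 1: move to `(ℙ, ℙ ∖ [0 : 1])`
  rw [omegaRelVec, relKroneckerM_map]
  set u := relativeSingularHomology.map ℤ ℤ (vecEmbed F) (mapsTo_vecEmbed F) 2 γ with hu
  have hu_gen : ∃ e : localHomology ℤ ℤ (ℙ ℂ (F × ℂ)) (zeroPt F) 2 ≃ₗ[ℤ] ℤ, e u = 1 := by
    haveI := isIso_map_vecEmbed F hF ℤ ℤ 2
    exact exists_linearEquiv_apply_eq_one_of_linearEquiv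
      (asIso (relativeSingularHomology.map ℤ ℤ (vecEmbed F) (mapsTo_vecEmbed F) 2)).toLinearEquiv hγ
  -- Step 2: `j : H₂(ℙ) → H₂(ℙ | [0 : 1])` is an isomorphism, `u = j c'` with `c'` a generator
  haveI := isIso_toLocal_of_homeomorph_sphere ℤ ℤ (n := 2) two_ne_zero (sphereHomeomorphModel F hF) (zeroPt F)
  set j := singularHomology.toLocal ℤ ℤ (zeroPt F) 2 with hj
  set c' := (asIso j).toLinearEquiv.symm u with hc'
  have hjc' : j c' = u := by
    have h := (asIso j).toLinearEquiv.apply_symm_apply u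
    rw [← hc'] at h
    exact h
  have hc'_gen : ∃ e : singularHomology ℤ ℤ (ℙ ℂ (F × ℂ)) 2 ≃ₗ[ℤ] ℤ, e c' = 1 :=
    exists_linearEquiv_apply_eq_one_of_linearEquiv (asIso j).toLinearEquiv.symm hu_gen
  -- Step 3: compare with the generator on which `ω(1)` is `1`
  obtain ⟨c, hc_gen, hc⟩ := exists_generator_kroneckerPairing_omegaModel_eq_one F hF
  have key : relKroneckerM ℤ (ℙ ℂ (F × ℂ)) (modelVectorPart F) 2 (omegaRel F hF ℤ ℤ 1) u =
      kroneckerPairing ℤ ℤ (ℙ ℂ (F × ℂ)) 2 (omegaModel F hF ℤ ℤ 1) c' := by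
    rw [← hjc', ← toAbsolute_omegaRel F hF ℤ ℤ 1, kroneckerPairing_toAbsolute]
    rfl
  rw [key]
  rcases eq_or_eq_neg_of_isGenerator hc'_gen hc_gen with h | h
  · left
    rw [h, hc]
  · right
    rw [h, map_neg, hc]

end Unit

end Literature.AlgebraicTopology.CharacteristicClasses
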